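import Mathlib
import HarnessLib

/-!
# The hermitian value of a column of an integral rank-one idempotent-up-to-a-unit is a NORM times a UNIT
(Kottwitz, *Stable trace formula: elliptic singular terms*, Math. Ann. 275 (1986), §7 (hyperspecial integrality of very regular
elements ⇒ trivial local invariant); Rogawski, *Automorphic Representations of Unitary Groups in Three Variables* (1990), §4.3 p. 44
(«`Δ_{G_v∕H_v}(γ_H, γ̄_v) = 1` for almost all `v`»), §14.6 p. 242 («`κ(γ, ψ_v(i(γ))) = +1` for almost all `v`»))

Topic `LinearAlgebra/Matrix`; namespace `Literature.LinearAlgebra.Matrix`.  THEOREMS ONLY over Mathlib: no definition, no named fact, no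
instance, no notation, no `sorry`.  Cell `pub/hodgecm-mathlib`, F0∕P3a, topic T6 node N3 (a.e. triviality of Rogawski's explicit finite transfer
factors, `F0/P3a/T6b-TREE.md` §9): the LOCAL LINEAR-ALGEBRA KERNEL of the `κ_v = +1` statement at a good place.

SETTING.  `K` a field of characteristic zero with a valuation `v` (integers `𝒪 = {v ≤ 1}`, units `{v = 1}`, maximal ideal `{v < 1}`), an
isometric ring involution `σ` of `K` (`σσ = 1`, `v ∘ σ = v`), and square matrices over `K` indexed by a finite type `n`:
* `J` INTEGRAL, `σ`-HERMITIAN (`(J.map σ)ᵀ = J`) and UNIMODULAR (an integral inverse `J⁻¹`);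
* `P` INTEGRAL with `P² = c P`, `tr P = c` for a UNIT `c` — so `π := c⁻¹ P` is an integral idempotent of rank one — and SELF-ADJOINT for `J` up to
  `σ(c)`: `Pᴴ J P = σ(c) · J P` (`Pᴴ := (P.map σ)ᵀ`), i.e. `πᴴ J π = J π` (the line `im π` is `J`-orthogonal to `ker π`).
In the application (★ `Rogawski1990.FinExplicitTransferFactor`): `K = L_w` at a place `w` of the CM field `L` NON-SPLIT over `v ∣ w` of `L⁺`, `σ` =
complex conjugation, `J = H′_w` (integral unimodular for almost all `v`), `P = P_v(γ_H, γ̄_v) = χ_g(γ̄_v)` (★ `finEigenlineProjector`: `γ̄_v` integral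
and `J`-unitary with the simple unit-norm eigenvalue `u = γ₂`, `c = χ_g(u)` a unit for almost all `v`; `P² = χ_g(u) P`, `tr P = χ_g(u)`, and
`Pᴴ H′ P = σ(χ_g(u)) H′ P` because the `u`-eigenline is `H′`-orthogonal to the other two), and the `(j, j)` entry of `Pᴴ J P` is ★
`finColumnFormValue … j`, whose norm class is the relative position `inv(ι(γ_H), γ̄_v)` read by ★ `finKappaAt`.

RESULT.  **`exists_norm_mul_unit_eq_conjTranspose_mul_mul_apply`**: for every column index `j` with `P e_j ≠ 0`,
  `(Pᴴ J P)_{jj} = z · σ(z) · e` with `z ≠ 0` and `e` a `σ`-FIXED UNIT (`v e = 1`, `σ e = e`).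
Hence (application, not here) `(Pᴴ J P)_{jj}` is a norm from `K^×` times a unit of the fixed field, so a norm at an unramified place — `κ_v = +1`.

PROOF (basis-free).  `π := c⁻¹P` is an idempotent of trace `1`, so its range is a line (Mathlib `LinearMap.IsProj.trace`: the trace of an idempotent is
the rank of its range; characteristic zero) and all `2 × 2` minors vanish: `π_{j₀j₀} π_{ik} = π_{ij₀} π_{j₀k}` (§1).  Since `Σ_i π_{ii} = 1` and `𝒪` is local,
some diagonal entry `π₀ := π_{j₀j₀}` is a unit; with the integral column `f := π e_{j₀}` and row `g := e_{j₀}ᵀ π` one has `π = f gᵀ ∕ π₀`, whence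
`(Pᴴ J P)_{jj} = N(c g_j ∕ π₀) · e` with `e := fᴴ J f ∈ 𝒪`, `σ`-fixed because `J` is hermitian (§2).  Finally `e` is a unit (§3): self-adjointness gives
`J f = πᴴ (J f)`, i.e. `(J f)_i = e · σ(g_i) ∕ σ(π₀)`; if `v e < 1` every coordinate of `J f` would lie in the maximal ideal, hence so would every
coordinate of `f = J⁻¹ (J f)` — but `f_{j₀} = π₀` is a unit.

## References
* R. E. Kottwitz, *Stable trace formula: elliptic singular terms*, Math. Ann. 275 (1986), §7 [Kottwitz1986].
* J. D. Rogawski, *Automorphic Representations of Unitary Groups in Three Variables*, Ann. of Math. Stud. 123 (1990), §4.3 p. 44, §14.6 p. 242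
  [Rogawski1990].
-/

set_option autoImplicit false

open Matrix
open scoped Matrix

namespace Literature.LinearAlgebra.Matrix

variable {K : Type*} [Field K] {n : Type*} [Fintype n] [DecidableEq n]

/-! ## §1 Rank one: the `2 × 2` minors of an idempotent of trace one vanish -/

/-- **An idempotent matrix of trace `1` over a field of characteristic zero has rank one: all its `2 × 2` minors vanish**,
`π_{j₀j₀} · π_{ik} = π_{ij₀} · π_{j₀k}` (the range of the projection `π` has dimension `tr π = 1` — Mathlib `LinearMap.IsProj.trace` —
so every column of `π` is a multiple of the column `j₀` as soon as that column is non-zero). [cite: Kottwitz1986, §7] -/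
theorem mul_apply_eq_mul_of_idempotent_trace_one [CharZero K] {π : Matrix n n K} (hπ : π * π = π) (htr : π.trace = 1)
    {j₀ : n} (hj₀ : π j₀ j₀ ≠ 0) (i k : n) : π j₀ j₀ * π i k = π i j₀ * π j₀ k := by
  -- the range of `π` is a line
  have hidem : IsIdempotentElem (Matrix.toLin' π) := by
    change Matrix.toLin' π * Matrix.toLin' π = Matrix.toLin' π
    rw [Module.End.mul_eq_comp, ← Matrix.toLin'_mul, hπ]
  have hrank : Module.finrank K (LinearMap.range (Matrix.toLin' π)) = 1 := by
    have h := ((LinearMap.isProj_range_iff_isIdempotentElem _).2 hidem).trace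
    rw [Matrix.trace_toLin'_eq, htr] at h
    exact_mod_cast h.symm
  -- the column `j₀` spans it
  set f : n → K := π.mulVec (Pi.single j₀ 1) with hf
  have hfcol : ∀ i, f i = π i j₀ := fun i => by rw [hf, Matrix.mulVec_single_one]; rfl
  have hfmem : f ∈ LinearMap.range (Matrix.toLin' π) := ⟨Pi.single j₀ 1, by rw [Matrix.toLin'_apply]⟩
  have hfne : (⟨f, hfmem⟩ : LinearMap.range (Matrix.toLin' π)) ≠ 0 := by
    intro h
    have h' : f j₀ = 0 := by
      have := congrArg (fun x : LinearMap.range (Matrix.toLin' π) => (x : n → K) j₀) h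
      simpa using this
    rw [hfcol] at h'
    exact hj₀ h'
  obtain ⟨t, ht⟩ := (finrank_eq_one_iff_of_nonzero' _ hfne).1 hrank
    ⟨π.mulVec (Pi.single k 1), ⟨Pi.single k 1, by rw [Matrix.toLin'_apply]⟩⟩
  have htk : ∀ i, t * π i j₀ = π i k := by
    intro i
    have h := congrArg (fun x : LinearMap.range (Matrix.toLin' π) => (x : n → K) i) ht
    simp only [SetLike.mk_smul_mk, Pi.smul_apply, smul_eq_mul] at h
    rw [hfcol i, Matrix.mulVec_single_one] at h
    exact h
  -- `t = π_{j₀k} ∕ π_{j₀j₀}`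
  have ht0 : t * π j₀ j₀ = π j₀ k := htk j₀
  calc π j₀ j₀ * π i k = π j₀ j₀ * (t * π i j₀) := by rw [htk i]
    _ = π i j₀ * (t * π j₀ j₀) := by ring
    _ = π i j₀ * π j₀ k := by rw [ht0]

/-- **Rank one for `P` with `P² = cP`, `tr P = c`, `c ≠ 0`**: `P_{j₀j₀} P_{ik} = P_{ij₀} P_{j₀k}` (apply the previous lemma to the idempotent
`c⁻¹P` of trace one). [cite: Kottwitz1986, §7] -/
theorem mul_apply_eq_mul_of_sq_eq_smul [CharZero K] {P : Matrix n n K} {c : K} (hc : c ≠ 0) (hPP : P * P = c • P)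
    (htr : P.trace = c) {j₀ : n} (hj₀ : P j₀ j₀ ≠ 0) (i k : n) : P j₀ j₀ * P i k = P i j₀ * P j₀ k := by
  have hππ : (c⁻¹ • P) * (c⁻¹ • P) = c⁻¹ • P := by
    rw [Matrix.smul_mul, Matrix.mul_smul, hPP, smul_smul, smul_smul, inv_mul_cancel_right₀ hc]
  have hπtr : (c⁻¹ • P).trace = 1 := by
    rw [Matrix.trace_smul, htr, smul_eq_mul, inv_mul_cancel₀ hc]
  have hπ₀ : (c⁻¹ • P) j₀ j₀ ≠ 0 := by
    rw [Matrix.smul_apply, smul_eq_mul]; exact mul_ne_zero (inv_ne_zero hc) hj₀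
  have h := mul_apply_eq_mul_of_idempotent_trace_one hππ hπtr hπ₀ i k
  simp only [Matrix.smul_apply, smul_eq_mul] at h
  have hc2 : c⁻¹ * c⁻¹ ≠ 0 := mul_ne_zero (inv_ne_zero hc) (inv_ne_zero hc)
  have h' : c⁻¹ * c⁻¹ * (P j₀ j₀ * P i k) = c⁻¹ * c⁻¹ * (P i j₀ * P j₀ k) := by linear_combination h
  exact mul_left_cancel₀ hc2 h'

/-! ## §2 The column value of `Pᴴ J P` is a norm times `fᴴ J f` -/

omit [DecidableEq n] in
/-- `((P.map σ)ᵀ * J * P) j j = Σ_a Σ_b σ(P a j) · J a b · P b j` (unfolding). [cite: Rogawski1990, §4.3 p. 44] -/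
theorem conjTranspose_mul_mul_apply (σ : K →+* K) (J P : Matrix n n K) (j : n) :
    ((P.map σ)ᵀ * J * P) j j = ∑ b, (∑ a, σ (P a j) * J a b) * P b j := by
  simp only [Matrix.mul_apply, Matrix.transpose_apply, Matrix.map_apply]

/-- **`(Pᴴ J P)_{jj} = N(c π_{j₀j} ∕ π_{j₀j₀}) · fᴴ J f`** for `P = c π`, `π` an idempotent of trace one with `π_{j₀j₀} ≠ 0`, `f = π e_{j₀}`:
the rank-one factorisation `π = f gᵀ ∕ π₀` inserted into §1's double sum. [cite: Kottwitz1986, §7] [cite: Rogawski1990, §4.3 p. 44] -/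
theorem conjTranspose_mul_mul_apply_eq_norm_mul [CharZero K] (σ : K →+* K) (J P : Matrix n n K) {c : K} (hc : c ≠ 0)
    (hPP : P * P = c • P) (htr : P.trace = c) {j₀ : n} (hj₀ : P j₀ j₀ ≠ 0) (j : n) :
    ((P.map σ)ᵀ * J * P) j j =
      (P j₀ j / P j₀ j₀) * σ (P j₀ j / P j₀ j₀) * ∑ b, (∑ a, σ (P a j₀) * J a b) * P b j₀ := by
  -- rank-one identity for `P`: `P_{j₀j₀} P_{ik} = P_{ij₀} P_{j₀k}`
  have hrkP : ∀ i k, P j₀ j₀ * P i k = P i j₀ * P j₀ k := mul_apply_eq_mul_of_sq_eq_smul hc hPP htr hj₀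
  -- every entry of the column `j` is the entry of the column `j₀` times `P_{j₀j} ∕ P_{j₀j₀}`
  have hcol : ∀ i, P i j = P i j₀ * (P j₀ j / P j₀ j₀) := by
    intro i
    rw [mul_div_assoc', eq_div_iff hj₀, mul_comm (P i j), hrkP i j]
  rw [conjTranspose_mul_mul_apply]
  -- substitute and factor
  have hσcol : ∀ a, σ (P a j) = σ (P a j₀) * σ (P j₀ j / P j₀ j₀) := fun a => by rw [hcol a, map_mul]
  set r : K := P j₀ j / P j₀ j₀ with hr
  have hinner : ∀ b, ∑ a, σ (P a j) * J a b = σ r * ∑ a, σ (P a j₀) * J a b := by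
    intro b
    rw [Finset.mul_sum]
    refine Finset.sum_congr rfl fun a _ => ?_
    rw [hσcol a]; ring
  calc ∑ b, (∑ a, σ (P a j) * J a b) * P b j
      = ∑ b, (r * σ r) * ((∑ a, σ (P a j₀) * J a b) * P b j₀) := by
        refine Finset.sum_congr rfl fun b _ => ?_
        rw [hinner b, hcol b]; ring
    _ = r * σ r * ∑ b, (∑ a, σ (P a j₀) * J a b) * P b j₀ := by rw [← Finset.mul_sum]

omit [DecidableEq n] in
/-- **`fᴴ J f` is `σ`-fixed for a `σ`-hermitian `J` and an involution `σ`** (`f = P e_{j₀}`). [cite: Rogawski1990, §4.3 p. 44] -/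
theorem map_columnHermitianValue_eq (σ : K →+* K) (hσσ : ∀ x, σ (σ x) = x) {J : Matrix n n K} (hJh : (J.map σ)ᵀ = J)
    (P : Matrix n n K) (j₀ : n) :
    σ (∑ b, (∑ a, σ (P a j₀) * J a b) * P b j₀) = ∑ b, (∑ a, σ (P a j₀) * J a b) * P b j₀ := by
  have hJ : ∀ a b, σ (J a b) = J b a := fun a b => by
    have h := congrArg (fun M : Matrix n n K => M b a) hJh
    simpa [Matrix.transpose_apply, Matrix.map_apply] using h
  simp only [map_sum, map_mul, hσσ, hJ, Finset.sum_mul]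
  rw [Finset.sum_comm]
  exact Finset.sum_congr rfl fun a _ => Finset.sum_congr rfl fun b _ => by ring

/-! ## §3 `fᴴ J f` is a unit -/

section Unit

variable {Γ₀ : Type*} [LinearOrderedCommGroupWithZero Γ₀] (v : Valuation K Γ₀)

/-- Integrality of a finite sum of products from integrality of the factors (ultrametric inequality). [cite: Kottwitz1986, §7] -/
theorem valuation_sum_mul_le_one {ι : Type*} (s : Finset ι) {x y : ι → K} (hx : ∀ i ∈ s, v (x i) ≤ 1) (hy : ∀ i ∈ s, v (y i) ≤ 1) :
    v (∑ i ∈ s, x i * y i) ≤ 1 := by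
  refine v.map_sum_le fun i hi => ?_
  rw [map_mul]
  exact mul_le_one' (hx i hi) (hy i hi)

/-- If every summand has valuation `< 1` then so has the sum (the maximal ideal is an ideal). [cite: Kottwitz1986, §7] -/
theorem valuation_sum_lt_one {ι : Type*} (s : Finset ι) {x : ι → K} (hx : ∀ i ∈ s, v (x i) < 1) :
    v (∑ i ∈ s, x i) < 1 := by
  classical
  induction s using Finset.induction_on with
  | empty => simp
  | insert a s ha ih =>
    rw [Finset.sum_insert ha]
    refine lt_of_le_of_lt (v.map_add _ _) (max_lt (hx a (Finset.mem_insert_self a s)) (ih fun i hi => hx i (Finset.mem_insert_of_mem hi)))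

/-- **`e := fᴴ J f` IS A UNIT** (`v e = 1`) when `J` is integral and unimodular, `P` integral with `P² = cP`, `tr P = c`, `v c = 1`,
`Pᴴ J P = σ(c) J P` (self-adjointness) and `P_{j₀j₀}` a unit: with `y := J f` (`f = P e_{j₀}`) self-adjointness reads `Σ_a σ(P_{ai}) y_a = σ(c) y_i`,
and the rank-one identity `P_{j₀j₀} P_{ai} = P_{aj₀} P_{j₀i}` turns its left side into `σ(P_{j₀i}) ∕ σ(P_{j₀j₀}) · e`; so `v e < 1` would put
every `y_i`, hence every coordinate of `f = J⁻¹ y`, in the maximal ideal — but `f_{j₀} = P_{j₀j₀}` is a unit. [cite: Kottwitz1986, §7]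
[cite: Rogawski1990, §4.3 p. 44] -/
theorem valuation_columnHermitianValue_eq_one [CharZero K] (σ : K →+* K) (hσv : ∀ x, v (σ x) = v x)
    {J Jinv P : Matrix n n K} (hJinv : ∀ a b, v (Jinv a b) ≤ 1) (hJJ : Jinv * J = 1)
    (hP : ∀ a b, v (P a b) ≤ 1) (hJ : ∀ a b, v (J a b) ≤ 1) {c : K} (hc : v c = 1) (hPP : P * P = c • P) (htr : P.trace = c)
    (hsa : (P.map σ)ᵀ * J * P = σ c • (J * P)) {j₀ : n} (hj₀ : v (P j₀ j₀) = 1) :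
    v (∑ b, (∑ a, σ (P a j₀) * J a b) * P b j₀) = 1 := by
  set e : K := ∑ b, (∑ a, σ (P a j₀) * J a b) * P b j₀ with he
  -- `e` is integral
  have hele : v e ≤ 1 := by
    refine valuation_sum_mul_le_one v _ (fun b _ => ?_) (fun b _ => hP b j₀)
    refine v.map_sum_le fun a _ => ?_
    rw [map_mul, hσv]
    exact mul_le_one' (hP a j₀) (hJ a b)
  have hc0 : c ≠ 0 := fun h => by rw [h, map_zero] at hc; exact zero_ne_one hc
  have hP₀ : P j₀ j₀ ≠ 0 := fun h => by rw [h, map_zero] at hj₀; exact zero_ne_one hj₀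
  have hσP₀ : σ (P j₀ j₀) ≠ 0 := fun h => by
    have : v (σ (P j₀ j₀)) = 0 := by rw [h, map_zero]
    rw [hσv, hj₀] at this; exact one_ne_zero this
  -- the rank-one identity for `P`
  have hrkP : ∀ i k, P j₀ j₀ * P i k = P i j₀ * P j₀ k := mul_apply_eq_mul_of_sq_eq_smul hc0 hPP htr hP₀
  -- `y := J f`, `f := P e_{j₀}`
  set y : n → K := fun i => ∑ b, J i b * P b j₀ with hydef
  -- the `(i, j₀)` entry of self-adjointness, regrouped: `Σ_a σ(P a i) y_a = σ(c) y_i`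
  have hy : ∀ i, ∑ a, σ (P a i) * y a = σ c * y i := by
    intro i
    have h := congrArg (fun M : Matrix n n K => M i j₀) hsa
    simp only [Matrix.mul_apply, Matrix.transpose_apply, Matrix.map_apply, Matrix.smul_apply, smul_eq_mul] at h
    rw [← h]
    simp only [hydef, Finset.mul_sum, Finset.sum_mul]
    rw [Finset.sum_comm]
    exact Finset.sum_congr rfl fun a _ => Finset.sum_congr rfl fun b _ => by ring
  -- `e = Σ_a σ(P a j₀) y_a`
  have he' : e = ∑ a, σ (P a j₀) * y a := by
    rw [he]
    simp only [hydef, Finset.mul_sum, Finset.sum_mul]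
    rw [Finset.sum_comm]
    exact Finset.sum_congr rfl fun a _ => Finset.sum_congr rfl fun b _ => by ring
  -- rank one on `σ`-images: `σ(P_{j₀j₀}) Σ_a σ(P a i) y_a = σ(P_{j₀ i}) e`
  have hkey : ∀ i, σ (P j₀ j₀) * (σ c * y i) = σ (P j₀ i) * e := by
    intro i
    rw [← hy i, he', Finset.mul_sum, Finset.mul_sum]
    refine Finset.sum_congr rfl fun a _ => ?_
    have h := congrArg σ (hrkP a i)
    rw [map_mul, map_mul] at h
    calc σ (P j₀ j₀) * (σ (P a i) * y a) = (σ (P j₀ j₀) * σ (P a i)) * y a := by ring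
      _ = (σ (P a j₀) * σ (P j₀ i)) * y a := by rw [h]
      _ = σ (P j₀ i) * (σ (P a j₀) * y a) := by ring
  -- suppose `v e < 1`
  by_contra hne
  have helt : v e < 1 := lt_of_le_of_ne hele hne
  -- then every `y_i` is in the maximal ideal
  have hσc : v (σ c) = 1 := by rw [hσv, hc]
  have hylt : ∀ i, v (y i) < 1 := by
    intro i
    have h := hkey i
    -- `v(σ P₀₀) · v(σ c) · v(y_i) = v(σ P_{j₀ i}) · v e ≤ v e < 1`
    have hv : v (σ (P j₀ j₀)) * (v (σ c) * v (y i)) = v (σ (P j₀ i)) * v e := by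
      simpa only [map_mul] using congrArg v h
    rw [hσv, hj₀, one_mul, hσc, one_mul] at hv
    rw [hv]
    calc v (σ (P j₀ i)) * v e ≤ v e := mul_le_of_le_one_left' (by rw [hσv]; exact hP j₀ i)
      _ < 1 := helt
  -- hence every coordinate of `f = J⁻¹ y` is in the maximal ideal; but `f_{j₀} = P_{j₀j₀}` is a unit
  have hf : P j₀ j₀ = ∑ b, Jinv j₀ b * y b := by
    have h := congrArg (fun M : Matrix n n K => (M * P) j₀ j₀) hJJ
    simp only [Matrix.one_mul] at h
    rw [← h, Matrix.mul_assoc]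
    simp only [Matrix.mul_apply, hydef]
  have hlt : v (P j₀ j₀) < 1 := by
    rw [hf]
    refine valuation_sum_lt_one v _ fun b _ => ?_
    rw [map_mul]
    calc v (Jinv j₀ b) * v (y b) ≤ v (y b) := mul_le_of_le_one_left' (hJinv j₀ b)
      _ < 1 := hylt b
  rw [hj₀] at hlt
  exact lt_irrefl _ hlt

omit [DecidableEq n] in
/-- **Some diagonal entry of `P` is a unit** when `P` is integral with unit trace `c` (the maximal ideal is closed under sums).
[cite: Kottwitz1986, §7] -/
theorem exists_valuation_diag_eq_one {P : Matrix n n K} (hP : ∀ a b, v (P a b) ≤ 1) {c : K} (hc : v c = 1)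
    (htr : P.trace = c) : ∃ j₀, v (P j₀ j₀) = 1 := by
  by_contra h
  have h' : ∀ i, v (P i i) ≠ 1 := fun i hi => h ⟨i, hi⟩
  have hlt : ∀ i ∈ (Finset.univ : Finset n), v (P i i) < 1 := fun i _ => lt_of_le_of_ne (hP i i) (h' i)
  have := valuation_sum_lt_one v _ hlt
  rw [show ∑ i ∈ Finset.univ, P i i = P.trace from rfl, htr, hc] at this
  exact lt_irrefl _ this

/-- **THE LOCAL KERNEL OF `κ_v = +1`.**  Let `K` be a field of characteristic zero with a valuation `v` and an isometric ring involution `σ`;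
`J` an integral, unimodular (`J⁻¹` integral), `σ`-hermitian matrix; `P` an integral matrix with `P² = cP`, `tr P = c`, `v c = 1`, self-adjoint
for `J` up to `σ(c)` (`Pᴴ J P = σ(c) · J P`).  Then for every column index `j` with `P e_j ≠ 0` the hermitian value of that column is a NORM
times a `σ`-FIXED UNIT: `(Pᴴ J P)_{jj} = z · σ(z) · e`, `z ≠ 0`, `v e = 1`, `σ e = e`.  (In the application `K = L_w`, `σ` = conjugation,
`J = H′_w`, `P = χ_g(γ̄_v)`: the relative position of `(γ_H, γ̄_v)` is a norm at every good non-split place, so Rogawski's `κ_v(γ_H, γ̄_v) = +1`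
for almost all `v`.) [cite: Kottwitz1986, §7] [cite: Rogawski1990, §4.3 p. 44; §14.6 p. 242] -/
theorem exists_norm_mul_unit_eq_conjTranspose_mul_mul_apply [CharZero K] (σ : K →+* K) (hσσ : ∀ x, σ (σ x) = x)
    (hσv : ∀ x, v (σ x) = v x)
    {J Jinv P : Matrix n n K} (hJ : ∀ a b, v (J a b) ≤ 1) (hJinv : ∀ a b, v (Jinv a b) ≤ 1) (hJJ : Jinv * J = 1)
    (hJh : (J.map σ)ᵀ = J)
    (hP : ∀ a b, v (P a b) ≤ 1) {c : K} (hc : v c = 1) (hPP : P * P = c • P) (htr : P.trace = c)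
    (hsa : (P.map σ)ᵀ * J * P = σ c • (J * P)) {j : n} (hj : ∃ i, P i j ≠ 0) :
    ∃ z e : K, z ≠ 0 ∧ v e = 1 ∧ σ e = e ∧ ((P.map σ)ᵀ * J * P) j j = z * σ z * e := by
  have hc0 : c ≠ 0 := fun h => by rw [h, map_zero] at hc; exact zero_ne_one hc
  obtain ⟨j₀, hj₀⟩ := exists_valuation_diag_eq_one v hP hc htr
  have hP₀ : P j₀ j₀ ≠ 0 := fun h => by rw [h, map_zero] at hj₀; exact zero_ne_one hj₀
  refine ⟨P j₀ j / P j₀ j₀, ∑ b, (∑ a, σ (P a j₀) * J a b) * P b j₀, ?_, ?_, ?_, ?_⟩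
  · -- `z ≠ 0`: the column `j` is `(P_{j₀j} ∕ P_{j₀j₀}) ·` the column `j₀`
    obtain ⟨i, hi⟩ := hj
    intro hz
    rw [div_eq_zero_iff, or_iff_left hP₀] at hz
    -- rank one: `P_{j₀j₀} P_{ij} = P_{ij₀} P_{j₀j} = 0`
    have hrk : P j₀ j₀ * P i j = P i j₀ * P j₀ j := mul_apply_eq_mul_of_sq_eq_smul hc0 hPP htr hP₀ i j
    rw [hz, mul_zero] at hrk
    exact hi ((mul_eq_zero.1 hrk).resolve_left hP₀)
  · exact valuation_columnHermitianValue_eq_one v σ hσv hJinv hJJ hP hJ hc hPP htr hsa hj₀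
  · exact map_columnHermitianValue_eq σ hσσ hJh P j₀
  · rw [conjTranspose_mul_mul_apply_eq_norm_mul σ J P hc0 hPP htr hP₀ j]

end Unit

end Literature.LinearAlgebra.Matrix
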